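import Summits.QuantumFields.YangMills.Theorems.AlphaInputsT3ACv3AvgIterLocality
import Summits.QuantumFields.YangMills.Theorems.AlphaInputsT3ACv3AdaptedClassX
import HarnessLib

/-!
# `AlphaInputsT3ACv3AvgIterLocalityRegions` — (FL) residual (r4), the REGION INSTANCES: the stencil ∕ regional two-block locality of `avg^s` (`…v3AvgIterLocality`) AT THE
# HISTORY REGIONS `Ω_j(h)`, `Λ_i(h) = lam42 Ω(h) k i` of the lane (unions of blocks of every level `≤` their own) and at the `hLift` objects `Ω_{k+1}(h)`, level-`k` data — lane
# `pub-balaban3d` ∕ cell `ym3-torus`, seat alpha-2 (g6)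

WHY.  `…v3AvgIterLocality` §3 states the regional locality for an arbitrary set `S` containing the `s`-block of each of its level-`s` centres.  The regions of record discharge that
hypothesis from the tree's saturation letters (`mem_Omega_iff_of_coarsen_eq`, `mem_lam42_iff_of_coarsen_eq` of `…v3AdaptedClassX` §1, `coarsen_toFine`): `Ω_j(h)` is a union of
`s`-blocks for every `s ≤ j ≤ k`, `Λ_i(h)` for every `s ≤ i ≤ k`.  THIS FILE records the instances BY NAME, generic in the gauge group and the averaging family, and the letter at the
`hLift` binder of `…v3InnerLiftFromRegionalThm1` (`Ω_{k+1}(h)` read at level `k+1`, data at level `k`, `(blockAvg ℰp)^k` on `bondsIn k Ω_{k+1}(h)`): two finest fields agreeing on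
`bondsIn 0 Ω_{k+1}(h)` have the same `k`-fold averages on `bondsIn k Ω_{k+1}(h)` — the free-seam form the regional Newton shell ∕ START v3 (D) consume.
WHAT (def-free).  §1 `sat_Omega`, `sat_lam42` (the saturation hypothesis of `iter_congr₂_bondsIn` at the regions); §2 ★ `iter_congr₂_Omega`, `iter_blockAvg_congr₂_Omega`,
`plaqHol_iter_congr₂_Omega`, ★ `iter_congr₂_lam42`, `iter_blockAvg_congr₂_lam42`; §3 T³: ★★ `AlphaInputsT3AC.iter_blockAvg_congr₂_OmegaSucc` (the `hLift` letter), `…_Omega_self`.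
HONEST FRAMING.  Kernel bookkeeping; no estimate; count-neutral helper toward the (FL)∕KIN row `hLift` of R3 2′∕2′χ (`stub_laneRecordsV3`, items 19935∕19936 — NOT proved here);
registry untouched; nothing about d = 4, the continuum limit, or a mass gap; YM₃ on T³ is rung R3, not the Clay problem.

References: T. Bałaban, Commun. Math. Phys. 102 (1985) 255–275 [Balaban1985UV3] ((38)–(42) p.266); CMP 102 (1985) 277–309 [Balaban1985Variational] ((3) p.278);
CMP 109 (1987) 249–301 [Balaban1987RG1] ((0.4) p.253).
-/

set_option autoImplicit false

namespace Summit.QuantumFields.YangMills.Theorems.AvgIterLocality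

open Literature.MathematicalPhysics.QuantumFieldTheory.Balaban1983to89
open Literature.MathematicalPhysics.QuantumFieldTheory.Balaban1983to89.T4ReflectionConeSharp (TwoBlockLocal twoBlockLocal_blockAvg)
open Literature.MathematicalPhysics.QuantumFieldTheory.Balaban1983to89.BlockAveraging (blockAvg)
open Literature.MathematicalPhysics.QuantumFieldTheory.Balaban1983to89.B10Eq38TorusDomains (toFine plaqsIn)
open Literature.MathematicalPhysics.QuantumFieldTheory.Balaban1983to89.B10Eq42TorusConstraint (bondsIn lam42)
open Summit.QuantumFields.Balaban3D.Carriers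

section Regions

variable {P : Params} {G : Type*} [GaugeGroup G] (M₁ : ℕ) (Rcol : ℕ → ℕ)

/-! ## §1 The regions contain the `s`-block of each of their level-`s` centres -/

/-- **`Ω_j(h)` IS `s`-SATURATED for every `s ≤ j ≤ k`** (standing range `s ≤ m + K`): if the level-`s` centre of the `s`-block of `w` lies in `Ω_j(h)`, so does `w`
(`mem_Omega_iff_of_coarsen_eq` with `coarsen s (toFine s (coarsen s w)) = coarsen s w`). [cite: Balaban1985UV3, (39) p.266] -/
theorem sat_Omega {k : ℕ} (h : Hist P k) {s j : ℕ} (hsj : s ≤ j) (hjk : j ≤ k) (hs : s ≤ P.m + P.K) (w : Site P 0)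
    (hw : toFine s (coarsen s w) ∈ Omega M₁ Rcol k h j) : w ∈ Omega M₁ Rcol k h j :=
  (mem_Omega_iff_of_coarsen_eq M₁ Rcol h hsj hjk (x := w) (y := toFine s (coarsen s w)) (coarsen_toFine s hs (coarsen s w)).symm).mpr hw

/-- **`Λ_i(h) = lam42 Ω(h) k i` IS `s`-SATURATED for every `s ≤ i ≤ k`** (standing range). [cite: Balaban1985UV3, (40)–(42) p.266] -/
theorem sat_lam42 {k : ℕ} (h : Hist P k) {s i : ℕ} (hsi : s ≤ i) (hik : i ≤ k) (hs : s ≤ P.m + P.K) (w : Site P 0)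
    (hw : toFine s (coarsen s w) ∈ lam42 (Omega M₁ Rcol k h) k i) : w ∈ lam42 (Omega M₁ Rcol k h) k i :=
  (mem_lam42_iff_of_coarsen_eq M₁ Rcol h hsi hik (x := w) (y := toFine s (coarsen s w)) (coarsen_toFine s hs (coarsen s w)).symm).mpr hw

/-! ## §2 Locality of `avg^s` at the regions -/

/-- **★ FREE-SEAM LOCALITY ON `Ω_j(h)`** (`s ≤ j ≤ k`, standing range): two finest configurations agreeing on the bonds with both endpoints in `Ω_j(h)` have the same `s`-fold averages
on every level-`s` bond with both endpoints in `Ω_j(h)`, for any two-block-local family. [cite: Balaban1985Variational, (3) p.278; Balaban1987RG1, (0.4) p.253] -/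
theorem iter_congr₂_Omega (av : ∀ j, Averaging P j G) (hav : ∀ j, TwoBlockLocal (av j)) {k : ℕ} (h : Hist P k) {s j : ℕ} (hsj : s ≤ j) (hjk : j ≤ k)
    (hs : s ≤ P.m + P.K) {U U' : GaugeField P 0 G} (hUU' : ∀ b : PBond P 0, b ∈ bondsIn 0 (Omega M₁ Rcol k h j) → U b = U' b)
    (c : PBond P s) (hc : c ∈ bondsIn s (Omega M₁ Rcol k h j)) :
    Averaging.iter av s U c = Averaging.iter av s U' c :=
  iter_congr₂_bondsIn av hav hs (sat_Omega M₁ Rcol h hsj hjk hs) hUU' c hc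

/-- `blockAvg` form of the free-seam locality on `Ω_j(h)`. [cite: Balaban1985Variational, (3) p.278; Balaban1987RG1, (0.4) p.253] -/
theorem iter_blockAvg_congr₂_Omega (ℰ : LoopAverage G) {k : ℕ} (h : Hist P k) {s j : ℕ} (hsj : s ≤ j) (hjk : j ≤ k)
    (hs : s ≤ P.m + P.K) {U U' : GaugeField P 0 G} (hUU' : ∀ b : PBond P 0, b ∈ bondsIn 0 (Omega M₁ Rcol k h j) → U b = U' b)
    (c : PBond P s) (hc : c ∈ bondsIn s (Omega M₁ Rcol k h j)) :
    Averaging.iter (fun i => (blockAvg ℰ : Averaging P i G)) s U c = Averaging.iter (fun i => (blockAvg ℰ : Averaging P i G)) s U' c :=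
  iter_congr₂_Omega M₁ Rcol (fun i => (blockAvg ℰ : Averaging P i G)) (fun _ => twoBlockLocal_blockAvg ℰ) h hsj hjk hs hUU' c hc

/-- Plaquette form on `Ω_j(h)`: equal holonomies of `avg^s U`, `avg^s U'` around every level-`s` plaquette with corners in `Ω_j(h)`. [cite: Balaban1985UV3, (38) p.266] -/
theorem plaqHol_iter_congr₂_Omega (av : ∀ j, Averaging P j G) (hav : ∀ j, TwoBlockLocal (av j)) {k : ℕ} (h : Hist P k) {s j : ℕ} (hsj : s ≤ j)
    (hjk : j ≤ k) (hs : s ≤ P.m + P.K) {U U' : GaugeField P 0 G} (hUU' : ∀ b : PBond P 0, b ∈ bondsIn 0 (Omega M₁ Rcol k h j) → U b = U' b)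
    (Q : Plaq P s) (hQ : Q ∈ plaqsIn s (Omega M₁ Rcol k h j)) :
    GaugeField.plaqHol (Averaging.iter av s U) Q = GaugeField.plaqHol (Averaging.iter av s U') Q :=
  plaqHol_iter_congr₂_plaqsIn av hav hs (sat_Omega M₁ Rcol h hsj hjk hs) hUU' Q hQ

/-- **★ FREE-SEAM LOCALITY ON `Λ_i(h)`** (`s ≤ i ≤ k`, standing range): agreement on the bonds inside `lam42 Ω(h) k i` gives agreement of the `s`-fold averages on
`bondsIn s (lam42 Ω(h) k i)` — the profile read bonds of the lane's rows. [cite: Balaban1985UV3, (40)–(42) p.266; Balaban1987RG1, (0.4) p.253] -/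
theorem iter_congr₂_lam42 (av : ∀ j, Averaging P j G) (hav : ∀ j, TwoBlockLocal (av j)) {k : ℕ} (h : Hist P k) {s i : ℕ} (hsi : s ≤ i) (hik : i ≤ k)
    (hs : s ≤ P.m + P.K) {U U' : GaugeField P 0 G} (hUU' : ∀ b : PBond P 0, b ∈ bondsIn 0 (lam42 (Omega M₁ Rcol k h) k i) → U b = U' b)
    (c : PBond P s) (hc : c ∈ bondsIn s (lam42 (Omega M₁ Rcol k h) k i)) :
    Averaging.iter av s U c = Averaging.iter av s U' c :=
  iter_congr₂_bondsIn av hav hs (sat_lam42 M₁ Rcol h hsi hik hs) hUU' c hc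

/-- `blockAvg` form of the free-seam locality on `Λ_i(h)`. [cite: Balaban1985UV3, (40)–(42) p.266; Balaban1987RG1, (0.4) p.253] -/
theorem iter_blockAvg_congr₂_lam42 (ℰ : LoopAverage G) {k : ℕ} (h : Hist P k) {s i : ℕ} (hsi : s ≤ i) (hik : i ≤ k)
    (hs : s ≤ P.m + P.K) {U U' : GaugeField P 0 G} (hUU' : ∀ b : PBond P 0, b ∈ bondsIn 0 (lam42 (Omega M₁ Rcol k h) k i) → U b = U' b)
    (c : PBond P s) (hc : c ∈ bondsIn s (lam42 (Omega M₁ Rcol k h) k i)) :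
    Averaging.iter (fun i => (blockAvg ℰ : Averaging P i G)) s U c = Averaging.iter (fun i => (blockAvg ℰ : Averaging P i G)) s U' c :=
  iter_congr₂_lam42 M₁ Rcol (fun i => (blockAvg ℰ : Averaging P i G)) (fun _ => twoBlockLocal_blockAvg ℰ) h hsi hik hs hUU' c hc

end Regions

/-! ## §3 The T³ objects: the `hLift` letter -/

section T3

open Literature.MathematicalPhysics.QuantumFieldTheory.Balaban1983to89.T3ContinuumYM3Torus
open Literature.MathematicalPhysics.QuantumFieldTheory.Balaban1985CMP102.Setting
open Summit.QuantumFields.Balaban3D.Carriers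
open Summit.QuantumFields.Balaban3D.Proofs.Primitives (AlphaConsts)

variable {F : T3Family} {𝔠 : AlphaConsts F.L (suGroupModel 2).N} {γ : ℝ} {hγ : 0 < γ} {hγ1 : γ ≤ (min 𝔠.gamma0 1) ^ 2} {K : ℕ}
variable {G : Type*} [GaugeGroup G]

/-- **★★ THE `hLift` LETTER** (`k + 1 ≤ K`): two finest fields on the three-torus `(F.P K)` that agree on the bonds with both endpoints in `Ω_{k+1}(h)` have the same `k`-fold (0.4)
averages `(blockAvg ℰ)^k` on `bondsIn k Ω_{k+1}(h)` — exactly the exactness clause of the `hLift` binder of `AlphaInputsT3AC.innerFineLiftsT3_of_regionalLifts` (there `ℰ = ℰp`,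
`G = SU(2)`), with FREE SEAM: the fields may differ arbitrarily on every bond with an endpoint outside `Ω_{k+1}(h)`. [cite: Balaban1985Variational, (3)+(8) pp.278–279; Balaban1987RG1, (0.4) p.253] -/
theorem AlphaInputsT3AC.iter_blockAvg_congr₂_OmegaSucc (ℰ : LoopAverage G) {k : ℕ} (hk : k + 1 ≤ K) (h : Hist (F.P K) (k + 1))
    {U U' : GaugeField (F.P K) 0 G}
    (hUU' : ∀ b : PBond (F.P K) 0, b ∈ bondsIn 0 (Omega 𝔠.lane.carrier.M₁
        (rcolOf (T3Scales F γ hγ (hγ1.trans (sq_min_one_le _ 𝔠.gamma0_pos)) K) 𝔠.lane.carrier) (k + 1) h (k + 1)) → U b = U' b)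
    (c : PBond (F.P K) k) (hc : c ∈ bondsIn k (Omega 𝔠.lane.carrier.M₁
        (rcolOf (T3Scales F γ hγ (hγ1.trans (sq_min_one_le _ 𝔠.gamma0_pos)) K) 𝔠.lane.carrier) (k + 1) h (k + 1))) :
    Averaging.iter (fun i => (blockAvg ℰ : Averaging (F.P K) i G)) k U c = Averaging.iter (fun i => (blockAvg ℰ : Averaging (F.P K) i G)) k U' c :=
  iter_blockAvg_congr₂_Omega _ _ ℰ h (Nat.le_succ k) le_rfl (AlphaInputsT3AC.le_standing_of_le (F := F) ((Nat.le_succ k).trans hk)) hUU' c hc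

/-- The same at a region read at its own level: `Ω_k(h)`, `h` at level `k ≤ K`, averages of every order `s ≤ k` on `bondsIn s Ω_k(h)`. [cite: Balaban1985Variational, (3) p.278; Balaban1987RG1, (0.4) p.253] -/
theorem AlphaInputsT3AC.iter_blockAvg_congr₂_Omega_self (ℰ : LoopAverage G) {k : ℕ} (hk : k ≤ K) (h : Hist (F.P K) k) {s : ℕ} (hs : s ≤ k)
    {U U' : GaugeField (F.P K) 0 G}
    (hUU' : ∀ b : PBond (F.P K) 0, b ∈ bondsIn 0 (Omega 𝔠.lane.carrier.M₁
        (rcolOf (T3Scales F γ hγ (hγ1.trans (sq_min_one_le _ 𝔠.gamma0_pos)) K) 𝔠.lane.carrier) k h k) → U b = U' b)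
    (c : PBond (F.P K) s) (hc : c ∈ bondsIn s (Omega 𝔠.lane.carrier.M₁
        (rcolOf (T3Scales F γ hγ (hγ1.trans (sq_min_one_le _ 𝔠.gamma0_pos)) K) 𝔠.lane.carrier) k h k)) :
    Averaging.iter (fun i => (blockAvg ℰ : Averaging (F.P K) i G)) s U c = Averaging.iter (fun i => (blockAvg ℰ : Averaging (F.P K) i G)) s U' c :=
  iter_blockAvg_congr₂_Omega _ _ ℰ h hs le_rfl (AlphaInputsT3AC.le_standing_of_le (F := F) (hs.trans hk)) hUU' c hc

end T3

end Summit.QuantumFields.YangMills.Theorems.AvgIterLocality
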